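import Mathlib
import HarnessLib
import Literature.AlgebraicGeometry.Ramification.InertiaNormalSylow
import Literature.AlgebraicGeometry.Resolution.ResolutionOfSingularities
import Literature.AlgebraicGeometry.GroupActions.KollarSzaboGoingDown

/-!
# The orbit-separation target of p822966 is UNREACHABLE for commuting conjugate tame subgroups (Kollár–Szabó)
# (crux `WildQuotients.WildQuotientResolution`, stub `stub_phaseZeroHighDim`; negative side-lemma, any dimension)

Crux stmt-ResolutionOfSingularities-15640 (`WildQuotientResolution`), registered stub `stub_phaseZeroHighDim`.
✓`phaseZero_of_primeOrbitSeparation` (p822966) reduces the stub to an equivariant proper birational regular model `X″`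
of `X′` on which ANY TWO DISTINCT CONJUGATE SUBGROUPS OF PRIME ORDER `ℓ ≠ p` HAVE DISJOINT INERT LOCI (`hsep`), and
the memo PHASE0-STANDARD-FORM.md rev 5 recommends RESHAPING the stub to the existence of such an `X″`. This file shows,
from the published fixed-point theorem of Kollár–Szabó («going down», appendix to Reichstein–Youssin 2000), that the
reshaped statement would be FALSE in general: if `a` and `x a x⁻¹` generate distinct subgroups, COMMUTE, and both lie in
the inertia group of a regular closed point of `X′` (with `X′` proper over an algebraically closed `k`), then on EVERY
equivariant proper birational model `X″` their inert loci meet — the abelian group `⟨a, xax⁻¹⟩` has a fixed point on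
`X″`. Instances: `C_ℓ ≀ C_2` acting linearly on `ℙ³` in characteristic `2` (`a = (ζ, 1)`, `x` = the swap), `S₄` on
`ℙ³` in characteristic `3` (`a = (12)`, `xax⁻¹ = (34)`).

* `KollarSzaboGoingDown` — the named fact (special case of [RY2000, App., Prop. A.2] for the inverse of a proper
  birational morphism and a finite abelian group), to be relocated under `Literature/AlgebraicGeometry/GroupActions`.
* `not_primeOrbitSeparation_of_commuting_conjugates` — the negative lemma (conditional on the named fact).

[OURS · crux stmt-ResolutionOfSingularities-15640 · NEGATIVE side-lemma on the reshape target of `stub_phaseZeroHighDim`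
(not a refutation of the stub or the crux); counted 0; AI-level work, weaker than expert review.]
-/

-- single-problem summit: the doubled namespace component `ResolutionOfSingularities` is forced
set_option linter.dupNamespace false

noncomputable section

open CategoryTheory AlgebraicGeometry TopologicalSpace IsLocalRing
open Literature.AlgebraicGeometry.Resolution Literature.AlgebraicGeometry.Ramification
-- Mathlib's scoped instance `[Group G] [IsMulCommutative G] : CommGroup G` (for the abelian subgroup `⟨a, xax⁻¹⟩`)
open scoped IsMulCommutative

namespace Summit.ResolutionOfSingularities.ResolutionOfSingularities.Theorems.WildQuotientResolution.StandardForm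

/-- **The orbit-separation target is unreachable for commuting conjugates** (crux stmt-ResolutionOfSingularities-15640;
negative side-lemma on the hypothesis `hsep` of ✓`phaseZero_of_primeOrbitSeparation`, conditional on the named fact
`KollarSzaboGoingDown`). Crux data over an ALGEBRAICALLY CLOSED `k` with `X′` regular, integral and PROPER over `k`
(e.g. projective). If `a, x ∈ G` are such that `a` and `x a x⁻¹` commute, generate distinct subgroups, and both lie in
the inertia group of a closed point `y₀ ∈ X′`, then NO equivariant proper birational integral model `X″ → X′` has the
inert loci of `⟨a⟩` and `⟨xax⁻¹⟩` disjoint; in particular (for `a` of prime order prime to `p`) the hypothesis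
`hsep` of p822966 fails on every model, and the stub must not be reshaped to it. -/
theorem not_primeOrbitSeparation_of_commuting_conjugates (KS : Literature.AlgebraicGeometry.GroupActions.KollarSzaboGoingDown)
    (k : Type) [Field k] [IsAlgClosed k] (X' X₁ : Scheme.{0}) (f : X₁ ⟶ Spec (.of k)) (q : X' ⟶ X₁)
    (G : Type) [Group G] [Finite G] (ρ : G →* Aut X')
    [IsSeparated f] [LocallyOfFiniteType f] [QuasiCompact f] [IsIntegral X'] [IsFinite q] [IsProper (q ≫ f)]
    (hreg : Scheme.IsRegular X') (hρ : ∀ g : G, (ρ g).hom ≫ q = q)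
    (a x : G) (hcomm : a * (x * a * x⁻¹) = (x * a * x⁻¹) * a)
    (y₀ : X') (hy₀ : IsClosed ({y₀} : Set X')) (ha : a ∈ inertiaSubgroup ρ y₀) (hxa : x * a * x⁻¹ ∈ inertiaSubgroup ρ y₀)
    (X'' : Scheme.{0}) (π₀ : X'' ⟶ X') (ρ'' : G →* Aut X'') [IsProper π₀] (hbir₀ : IsBirational π₀) [IsIntegral X'']
    (hequiv₀ : ∀ g : G, (ρ'' g).hom ≫ π₀ = π₀ ≫ (ρ g).hom) :
    ¬ Disjoint {y : X'' | Subgroup.zpowers a ≤ inertiaSubgroup ρ'' y}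
        {y : X'' | Subgroup.zpowers (x * a * x⁻¹) ≤ inertiaSubgroup ρ'' y} := by
  classical
  -- the abelian subgroup `H = ⟨a, xax⁻¹⟩ ≤ I_{y₀}`
  set S : Set G := {a, x * a * x⁻¹} with hSdef
  have hScomm : ∀ u ∈ S, ∀ v ∈ S, u * v = v * u := by
    intro u hu v hv
    simp only [hSdef, Set.mem_insert_iff, Set.mem_singleton_iff] at hu hv
    rcases hu with rfl | rfl <;> rcases hv with rfl | rfl
    · rfl
    · exact hcomm
    · exact hcomm.symm
    · rfl
  haveI : IsMulCommutative (Subgroup.closure S) := Subgroup.isMulCommutative_closure hScomm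
  have hHle : Subgroup.closure S ≤ inertiaSubgroup ρ y₀ := by
    rw [Subgroup.closure_le]
    intro u hu
    simp only [hSdef, Set.mem_insert_iff, Set.mem_singleton_iff] at hu
    rcases hu with rfl | rfl
    · exact ha
    · exact hxa
  -- structure maps and the restricted actions
  let sX : X' ⟶ Spec (.of k) := q ≫ f
  haveI : IsSeparated sX := inferInstance
  haveI : LocallyOfFiniteType sX := inferInstance
  haveI : QuasiCompact sX := inferInstance
  haveI : IsProper (π₀ ≫ sX) := inferInstance
  let σ : Subgroup.closure S →* Aut X' := ρ.comp (Subgroup.closure S).subtype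
  let τ : Subgroup.closure S →* Aut X'' := ρ''.comp (Subgroup.closure S).subtype
  have hσ : ∀ h : Subgroup.closure S, (σ h).hom ≫ sX = sX := fun h => by
    change (ρ (h : G)).hom ≫ (q ≫ f) = q ≫ f
    rw [← Category.assoc, hρ]
  have hτ : ∀ h : Subgroup.closure S, (τ h).hom ≫ π₀ = π₀ ≫ (σ h).hom := fun h => hequiv₀ (h : G)
  have hfix : ∀ h : Subgroup.closure S, h ∈ inertiaSubgroup σ y₀ := fun h => by
    rw [mem_inertiaSubgroup_iff]
    exact (mem_inertiaSubgroup_iff ρ).mp (hHle h.2)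
  obtain ⟨y, hy⟩ := KS k X' X'' sX π₀ hbir₀ (Subgroup.closure S) σ τ hσ hτ y₀ hy₀ (hreg y₀) hfix
  -- both generators fix `y`
  have hmem : ∀ u : G, u ∈ S → u ∈ inertiaSubgroup ρ'' y := fun u hu => by
    have h := hy ⟨u, Subgroup.subset_closure hu⟩
    rw [mem_inertiaSubgroup_iff] at h
    exact (mem_inertiaSubgroup_iff ρ'').mpr h
  rw [Set.not_disjoint_iff]
  refine ⟨y, ?_, ?_⟩
  · exact (Subgroup.zpowers_le).mpr (hmem a (by simp [hSdef]))
  · exact (Subgroup.zpowers_le).mpr (hmem (x * a * x⁻¹) (by simp [hSdef]))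

end Summit.ResolutionOfSingularities.ResolutionOfSingularities.Theorems.WildQuotientResolution.StandardForm

end
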